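import Literature.MathematicalPhysics.QuantumLattice.SpinLiquid
import Literature.MathematicalPhysics.QuantumLattice.FinDimSpectrumSpectralGapProofs
import HarnessLib

/-!
# Discharges: the ground-cluster projection is a spectral projection (`SpinLiquid`)

Sibling proof file of `Literature/MathematicalPhysics/QuantumLattice/SpinLiquid.lean` (trunk
QLatticeAQFT, item Q14; the first sibling is `SpinLiquidProofs.lean`). It discharges two named
facts (`def X : Prop`, D-0014) of that file as `theorem X_holds : X`, from Mathlib's spectral
theorem for Hermitian matrices and the accepted prelude (`FinDimSpectrum`,
`FinDimSpectrumProofs`, `FinDimSpectrumSpectralGapProofs`). No statement or definition is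
introduced or changed; the helpers are `private`.

* `Literature.MathematicalPhysics.QuantumLattice.groundClusterProj_eq_groundProj_holds :
  groundClusterProj_eq_groundProj` — if the Hermitian matrix `H` has a cluster gap
  `H.HasClusterGap m 0 γ` (exactly `m` eigenvalues, counted with multiplicity, equal to the least
  eigenvalue `E₀ = ⨅ i, λᵢ`, all others `≥ E₀ + γ`, `γ > 0`), then the ground-cluster projection
  `groundClusterProj H m` (orthogonal projection onto the span of the eigenvectors belonging to
  the last `m` indices of Mathlib's decreasingly sorted enumeration `IsHermitian.eigenvalues₀`)
  equals the ground-state projection `H.groundProj` (orthogonal projection onto `ker (H - E₀)`).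
* `Literature.MathematicalPhysics.QuantumLattice.groundClusterProj_commute_holds :
  groundClusterProj_commute` — `groundClusterProj H m` commutes with `H` (for every `H`, `m`;
  the non-Hermitian junk value `0` trivially).

## Source

S. Michalakis, J. P. Zwolak, *Stability of frustration-free Hamiltonians*, Comm. Math. Phys.
**322** (2013) 277–302 = arXiv:1109.1588 (held copy, read): §2 ("For `P₀` the projector onto the
groundstate subspace of `H₀` …"; "`H₀` has a spectral gap `γ_L ≥ γ > 0` above the groundstate
subspace") and §4, Definition 3 (`P_B(ε)` = the projection onto the subspace of eigenstates of
`H_B` with energy at most `ε`, a spectral projection of `H_B`) with Corollary 1, items 2 and 4: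
"`P_Λ(ε) = P₀` for `0 ≤ ε ≤ γ`" and "`P_B(ε) = P_B(0)` if `H_B` has spectral gap greater than
`ε`", whose printed proof is "follows from the definition of `P_B(ε)` and the spectral
decomposition of `H_B`". The first discharged fact is the `ε = 0` instance in the tree's
finite-dimensional vocabulary (`Matrix.HasClusterGap m 0 γ`, `groundClusterProj`,
`Matrix.groundProj`); the second is the statement that such a projection is spectral (commutes
with `H_B`). Both proofs below are exactly that spectral-decomposition argument, over Mathlib's
spectral theorem for Hermitian matrices (`Matrix.IsHermitian.eigenvectorBasis`,
`eigenvalues₀_antitone`, `LinearMap.IsSymmetric.apply_eigenvectorBasis`).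

## Proofs

Let `e : Fin (card n) ≃ n` be the reindexing of `Matrix.IsHermitian.eigenvalues/eigenvectorBasis`
(`eigenvalues (e j) = eigenvalues₀ j`), `N = card n`, `E₀ = ⨅ i, λᵢ`. The cluster hypothesis says
`#{j : Fin N | eigenvalues₀ j ≤ E₀} = m`. Since `eigenvalues₀` is antitone, the set
`{j | eigenvalues₀ j ≤ E₀}` is an upper set of `Fin N`; an upper set of cardinality `m` is the set
of the last `m` indices `{j | N ≤ j + m}` (`eigenvalues₀_le_iff_card_le_add`: if `j` is among the
last `m` indices but `eigenvalues₀ j > E₀` then the filter sits inside `Ioi j`, of cardinality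
`N - 1 - j < m`; if `eigenvalues₀ j ≤ E₀` but `j + m < N` then `Ici j`, of cardinality `N - j > m`,
sits inside the filter). Hence every vector `eigenvectorBasis (e j)`, `N ≤ j + m`, is an
eigenvector of `toEuclideanLin H` for `E₀ = groundEnergy H` (`groundEnergy_eq_iInf_eigenvalues`),
so the span in `groundClusterProj` is contained in the (Euclidean copy of the) ground space
(`Matrix.eigenspace_toEuclideanLin_eq_map`); both have dimension `m` (orthonormal vectors are
linearly independent, `finrank_span_eq_card`; `HasClusterGap.groundStateDegeneracy_eq`,
`Matrix.finrank_eigenspace_toEuclideanLin`), so they coincide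
(`Submodule.eq_of_le_of_finrank_le`), and so do their projection matrices.

For the commutation: the span `K` is invariant under `toEuclideanLin H` (each generator is an
eigenvector), so for `P = projMatrix K` and every `v`, `P v ∈ K` and `H (P v) ∈ K` is fixed by
`P`: `H P = P (H P)`. The right-hand side is Hermitian (`P`, `H` Hermitian), hence
`H P = (H P)ᴴ = P H`.
-/

noncomputable section

open Matrix Finset
open scoped Matrix.Norms.L2Operator ComplexOrder MatrixOrder InnerProductSpace

namespace Literature.MathematicalPhysics.QuantumLattice

variable {n : Type*} [Fintype n] [DecidableEq n]

/-- Counting lemma for a decreasing enumeration: if exactly `m` of the sorted eigenvalues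
`eigenvalues₀ j`, `j : Fin (card n)`, are `≤ c`, then (by antitonicity,
`Matrix.IsHermitian.eigenvalues₀_antitone`) these are exactly the last `m` indices,
`eigenvalues₀ j ≤ c ↔ card n ≤ j + m` (`Fin.card_Ioi`, `Fin.card_Ici`). [folklore] -/
private theorem eigenvalues₀_le_iff_card_le_add {A : Matrix n n ℂ} (hA : A.IsHermitian) {c : ℝ}
    {m : ℕ} (hm : #{j : Fin (Fintype.card n) | hA.eigenvalues₀ j ≤ c} = m)
    (j : Fin (Fintype.card n)) :
    hA.eigenvalues₀ j ≤ c ↔ Fintype.card n ≤ j + m := by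
  have hanti := hA.eigenvalues₀_antitone
  constructor
  · intro hj
    by_contra hlt
    have hsub : Finset.Ici j ⊆ ({j' : Fin (Fintype.card n) | hA.eigenvalues₀ j' ≤ c} : Finset _) :=
      fun j' hj' => by
        rw [Finset.mem_Ici] at hj'
        simp only [Finset.mem_filter, Finset.mem_univ, true_and]
        exact (hanti hj').trans hj
    have hcard := Finset.card_le_card hsub
    rw [Fin.card_Ici, hm] at hcard
    omega
  · intro hj
    by_contra hgt
    rw [not_le] at hgt
    have hsub : ({j' : Fin (Fintype.card n) | hA.eigenvalues₀ j' ≤ c} : Finset _) ⊆ Finset.Ioi j :=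
      fun j' hj' => by
        simp only [Finset.mem_filter, Finset.mem_univ, true_and] at hj'
        rw [Finset.mem_Ioi]
        exact not_le.mp fun hle => ((hgt.trans_le (hanti hle)).trans_le hj').false
    have hcard := Finset.card_le_card hsub
    rw [Fin.card_Ioi, hm] at hcard
    omega

/-- Each vector of Mathlib's eigenvector basis of a Hermitian matrix `A` is an eigenvector of
`toEuclideanLin A` for the corresponding eigenvalue (Mathlib
`LinearMap.IsSymmetric.apply_eigenvectorBasis`, through the reindexing in the definition of
`Matrix.IsHermitian.eigenvectorBasis`). [folklore] -/
private theorem toEuclideanLin_eigenvectorBasis {A : Matrix n n ℂ} (hA : A.IsHermitian) (i : n) :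
    toEuclideanLin A (hA.eigenvectorBasis i) =
      ((hA.eigenvalues i : ℝ) : ℂ) • hA.eigenvectorBasis i := by
  simp only [Matrix.IsHermitian.eigenvectorBasis, Matrix.IsHermitian.eigenvalues,
    OrthonormalBasis.reindex_apply]
  exact (Matrix.isSymmetric_toEuclideanLin_iff.mpr hA).apply_eigenvectorBasis
    finrank_euclideanSpace _

/-- **Discharge of `groundClusterProj_eq_groundProj`.** Under a cluster gap of width `0` with `m`
states, `H.HasClusterGap m 0 γ`, the ground-cluster projection onto the `m` lowest sorted
eigenvectors is the ground-state projection: `groundClusterProj H m = H.groundProj`.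
Michalakis–Zwolak, CMP 322 (2013), §2 (the projector `P₀` onto the groundstate subspace of a
Hamiltonian gapped above it) and §4, Definition 3 / Corollary 1 (items 2, 4: the projection onto
the eigenstates of energy `≤ ε` is `P₀` for `ε` below the gap, "from the definition and the
spectral decomposition"); here the `ε = 0` instance, proved by that spectral-decomposition
argument: the last `m` sorted eigenvalues are exactly those equal to `E₀`
(`eigenvalues₀_le_iff_card_le_add`), so the span of the corresponding eigenvectors lies in the
ground space and has the same dimension `m`. [cite: MichalakisZwolak2013, §4 Corollary 1] -/
theorem groundClusterProj_eq_groundProj_holds : groundClusterProj_eq_groundProj (n := n) := by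
  intro H m γ h
  have hdeg : H.groundStateDegeneracy = m := h.groundStateDegeneracy_eq
  obtain ⟨hA, -, -, hcard, -⟩ := h
  simp only [add_zero] at hcard
  have hE : H.groundEnergy = ⨅ i, hA.eigenvalues i := groundEnergy_eq_iInf_eigenvalues_holds hA
  -- the cluster count in terms of the sorted enumeration
  have hcount : #{j : Fin (Fintype.card n) | hA.eigenvalues₀ j ≤ ⨅ i, hA.eigenvalues i} = m := by
    rw [← hcard]
    refine Finset.card_equiv (Fintype.equivOfCardEq (Fintype.card_fin _)) fun j => ?_
    simp only [Finset.mem_filter, Finset.mem_univ, true_and, hA.eigenvalues_equivOfCardEq]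
  -- the last `m` sorted eigenvalues are the ground energy
  have hlast : ∀ j : Fin (Fintype.card n), Fintype.card n ≤ j + m →
      hA.eigenvalues (Fintype.equivOfCardEq (Fintype.card_fin _) j) = H.groundEnergy := by
    intro j hj
    refine le_antisymm ?_ (groundEnergy_le_eigenvalues hA _)
    rw [hA.eigenvalues_equivOfCardEq, hE]
    exact (eigenvalues₀_le_iff_card_le_add hA hcount j).mpr hj
  rw [groundClusterProj, dif_pos hA, Matrix.groundProj, Matrix.groundSpace,
    ← Matrix.eigenspace_toEuclideanLin_eq_map]
  congr 1
  apply Submodule.eq_of_le_of_finrank_le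
  · rw [Submodule.span_le]
    rintro _ ⟨j, rfl⟩
    rw [SetLike.mem_coe, Module.End.mem_eigenspace_iff, toEuclideanLin_eigenvectorBasis hA,
      hlast j.1 j.2]
  · have hli : LinearIndependent ℂ
        fun j : {j : Fin (Fintype.card n) // Fintype.card n ≤ (j : ℕ) + m} =>
          hA.eigenvectorBasis (Fintype.equivOfCardEq (Fintype.card_fin _) j.1) :=
      hA.eigenvectorBasis.orthonormal.linearIndependent.comp
        (fun j : {j : Fin (Fintype.card n) // Fintype.card n ≤ (j : ℕ) + m} =>
          Fintype.equivOfCardEq (Fintype.card_fin _) j.1)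
        ((Fintype.equivOfCardEq (Fintype.card_fin _)).injective.comp Subtype.val_injective)
    rw [finrank_span_eq_card hli, Fintype.card_subtype, Matrix.finrank_eigenspace_toEuclideanLin]
    change H.groundStateDegeneracy ≤ _
    rw [hdeg]
    calc m = #{j : Fin (Fintype.card n) | hA.eigenvalues₀ j ≤ ⨅ i, hA.eigenvalues i} := hcount.symm
      _ ≤ _ := Finset.card_le_card fun j hj => by
        simp only [Finset.mem_filter, Finset.mem_univ, true_and] at hj ⊢
        exact (eigenvalues₀_le_iff_card_le_add hA hcount j).mp hj

/-- **Discharge of `groundClusterProj_commute`.** The ground-cluster projection commutes with the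
Hamiltonian: `Commute (groundClusterProj H m) H`. For non-Hermitian `H` the projection is the
junk value `0`; for Hermitian `H` the span `K` of the chosen eigenvectors is invariant under
`toEuclideanLin H` (`toEuclideanLin_eigenvectorBasis`), so with `P = projMatrix K` one has
`H P = P (H P)` (columnwise: `P v ∈ K`, hence `H (P v) ∈ K` is fixed by `P`), and `P (H P)` is
Hermitian, whence `H P = (H P)ᴴ = P H`. Michalakis–Zwolak, CMP 322 (2013), §2 and §4
(Definition 3: `P_B(ε)` is a spectral projection of `H_B`, "the spectral decomposition of
`H_B`"). [cite: MichalakisZwolak2013, §4 Definition 3] -/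
theorem groundClusterProj_commute_holds : groundClusterProj_commute (n := n) := by
  intro H m
  by_cases hA : H.IsHermitian
  swap
  · rw [groundClusterProj, dif_neg hA]
    exact Commute.zero_left H
  rw [groundClusterProj, dif_pos hA]
  set K : Submodule ℂ (EuclideanSpace ℂ n) := Submodule.span ℂ (Set.range
    fun j : {j : Fin (Fintype.card n) // Fintype.card n ≤ (j : ℕ) + m} =>
      hA.eigenvectorBasis (Fintype.equivOfCardEq (Fintype.card_fin _) j.1)) with hK
  -- `K` is invariant under `H`
  have hinv : ∀ x ∈ K, toEuclideanLin H x ∈ K := by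
    have hle : K.map (toEuclideanLin H) ≤ K := by
      rw [hK, Submodule.map_span_le]
      rintro _ ⟨j, rfl⟩
      rw [toEuclideanLin_eigenvectorBasis hA]
      exact Submodule.smul_mem _ _ (Submodule.subset_span ⟨j, rfl⟩)
    exact fun x hx => hle (Submodule.mem_map_of_mem hx)
  -- `H P = P (H P)`
  have h1 : H * projMatrix K = projMatrix K * (H * projMatrix K) := by
    rw [ext_iff_mulVec]
    intro v
    rw [← mulVec_mulVec, ← mulVec_mulVec, ← mulVec_mulVec]
    have hPv : projMatrix K *ᵥ v = (K.starProjection (WithLp.toLp 2 v) : n → ℂ) :=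
      projMatrix_mulVec K (WithLp.toLp 2 v)
    have hmem : toEuclideanLin H (K.starProjection (WithLp.toLp 2 v)) ∈ K :=
      hinv _ (K.starProjection_apply_mem _)
    have h2 := projMatrix_mulVec K (toEuclideanLin H (K.starProjection (WithLp.toLp 2 v)))
    rw [Submodule.starProjection_eq_self_iff.mpr hmem] at h2
    rw [hPv]
    exact h2.symm
  have hP : (projMatrix K)ᴴ = projMatrix K := (projMatrix_isHermitian K).eq
  have h2 : (H * projMatrix K)ᴴ = H * projMatrix K := by
    conv_lhs => rw [h1]
    rw [conjTranspose_mul, conjTranspose_mul, hP, hA.eq, Matrix.mul_assoc, ← h1]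
  show projMatrix K * H = H * projMatrix K
  rw [← h2, conjTranspose_mul, hP, hA.eq]

end Literature.MathematicalPhysics.QuantumLattice
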